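import Mathlib
import HarnessLib
import Summits.ValiantsHypothesis.ValiantsHypothesis.Theorems.MonotoneRestorationMonotoneRestorationQPLinearWidthCFIHomMonotoneAbsorbing
import Summits.ValiantsHypothesis.ValiantsHypothesis.Theorems.MonotoneRestorationMonotoneRestorationQPLinearWidthCFIHomMonotoneWeighted

/-!
# Route MonotoneRestoration, crux `MonotoneRestorationQP` (stmt-15886), line `linear_width` —
# THE APEXED CFI PAIR `CFI(G,T) ∨ K₂`: `C^k`-equivalent, and distinguished by EVERY bipartite pattern containing an
# INDUCED copy of the 2-subdivision `G₂` (unconditional linear-size witnesses for sparse wide patterns)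

Helper file (`--supports stmt-ValiantsHypothesis-15886`), def-free; steps (P3)+(P4) of the g13 census assembled on top of
`CFIHomMonotone` (p841399), `…Weighted` (p841417), `…Absorbing` (p841425).

The obstruction to using the bare CFI pair against a general pattern `F ⊇ G₂` was that the rest of `F` has nowhere to go
(strictness needs a retraction `F → G₂`).  JOIN BOTH HOSTS WITH AN EDGE `K₂` (two adjacent apices seeing everything):
* `isPartialIso_compl`, `ckEquiv_compl` — `≡_{C^k}` is invariant under COMPLEMENTATION (same Duplicator strategy: partial
  isomorphisms of the complements are the partial isomorphisms); with the tree's `CkEquiv.sum` (disjoint unions) this gives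
  `ckEquiv_apex` — **the apexed pair is `C^k`-equivalent whenever the pair is**: `X ∨ K₂ = (Xᶜ ⊔ ⊥₂)ᶜ`;
* `apex_adj_*` — the adjacency of `(Xᶜ ⊕g ⊥)ᶜ` on `U ⊕ Fin 2` (the join with `K₂`, written with tree/Mathlib primitives only);
* `card_hom_apex_lt_of_retract` — strictness for the apexed pair from `card_hom_ext_lt_of_retract` (all cross edges present, so
  the shadow-invariance hypotheses are trivial);
* `exists_apexRetraction_of_embedding` — **ABSORPTION**: a bipartite `F` (a `2`-colouring) with an INDUCED copy
  `ι : G₂ ↪g F` retracts onto `G₂ ∨ K₂` (copy ↦ itself, everything else ↦ the apex of its colour);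
* `apexWitness_of_embedding` — **THE WITNESSES**: `G` connected on `≥ 2` vertices, `tw G ≥ k ≥ 1`, `e` an edge, `F` bipartite
  with an induced copy of `G₂` ⇒ `CFI(G,∅) ∨ K₂ ≡_{C^k} CFI(G,{e}) ∨ K₂` and `hom(F, CFI(G,{e}) ∨ K₂) < hom(F, CFI(G,∅) ∨ K₂)`;
  `exists_fin_apexWitness_of_embedding` (hosts on `Fin m`, `m = |CFI(G)| + 2`) and
  `exists_homIndist_apexWitness_of_embedding` (the line's weighted currency, for patterns `E` with `patternGraph E ⊇` an
  induced `G₂`: a `HomIndist ν k` pair separating `hom_E`, `ν = |CFI(G)| + 2`).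

So: EVERY bipartite pattern containing an induced 2-subdivision of a connected graph of tree-width `≥ k` and maximum degree
`Δ` is separated by a `HomIndist`-pair at level `≤ v·2^Δ + 2vΔ + 2` — LINEAR in the base for bounded `Δ`, unconditionally.
What remains of the census plan for the sparse `√N` rung: (P1) excluded grid / degree-3 sparsifier BY NAME and (P2) an induced
2-subdivided subcubic wide subgraph inside a subdivided wall; dense wide patterns (`K_{d,d}`, no induced `P₄`) are NOT covered.
No stub closed; θ₁, the cruxes and VP ≠ VNP NOT moved.
[cite: ChenFlumLiu2025, Thm 11.1, Thm 12.2; Roberson2022, Thm 3.6; Dvorak2010, Thm 6; GroheOtto2015, §2]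
-/

set_option linter.dupNamespace false

noncomputable section

open scoped Classical

namespace Summit.ValiantsHypothesis.ValiantsHypothesis.Theorems.CFIHomMonotone

open MvPolynomial
open Literature.ModelTheory.FiniteModelTheory Literature.ModelTheory.FiniteModelTheory.ChenFlumLiu2025
open Literature.Computability.AlgebraicComplexity
open Summit.ValiantsHypothesis.ValiantsHypothesis.Theorems.MonotoneRestorationQPLinearWidth

/-! ### `≡_{C^k}` is invariant under complementation; the apexed pair is `C^k`-equivalent -/

/-- Partial isomorphisms of two graphs are partial isomorphisms of their complements. [cite: GroheOtto2015, §2] -/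
theorem isPartialIso_compl {α β : Type*} {X : SimpleGraph α} {Y : SimpleGraph β} {p : Set (α × β)}
    (h : IsPartialIso X Y p) : IsPartialIso Xᶜ Yᶜ p := by
  refine ⟨h.eq_iff, fun x hx y hy => ?_⟩
  rw [SimpleGraph.compl_adj, SimpleGraph.compl_adj]
  exact and_congr (not_congr (h.eq_iff hx hy)) (not_congr (h.adj_iff hx hy))

/-- **`≡_{C^k}` is invariant under complementation** (Duplicator plays the same strategy). [cite: GroheOtto2015, §2 (Thm 2.2)] -/
theorem ckEquiv_compl {α β : Type*} {X : SimpleGraph α} {Y : SimpleGraph β} {k : ℕ} (h : CkEquiv k X Y) :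
    CkEquiv k Xᶜ Yᶜ := by
  obtain ⟨S⟩ := h
  exact ⟨{ carrier := S.carrier
           empty_mem := S.empty_mem
           finite_of_mem := S.finite_of_mem
           ncard_le_of_mem := S.ncard_le_of_mem
           isPartialIso_of_mem := fun p hp => isPartialIso_compl (S.isPartialIso_of_mem hp)
           mem_of_subset := S.mem_of_subset
           forth := S.forth }⟩

/-- **The apexed pair is `C^k`-equivalent**: `X ≡_{C^k} Y ⇒ X ∨ K₂ ≡_{C^k} Y ∨ K₂`, the join with an edge written as
`(Xᶜ ⊕g ⊥)ᶜ` on `· ⊕ Fin 2` (complement, disjoint union with two isolated vertices, complement).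
[cite: GroheOtto2015, §2 (Thm 2.2)] -/
theorem ckEquiv_apex {α β : Type*} {X : SimpleGraph α} {Y : SimpleGraph β} {k : ℕ} (h : CkEquiv k X Y) :
    CkEquiv k (Xᶜ ⊕g (⊥ : SimpleGraph (Fin 2)))ᶜ (Yᶜ ⊕g (⊥ : SimpleGraph (Fin 2)))ᶜ :=
  ckEquiv_compl ((ckEquiv_compl h).sum (CkEquiv.refl _ k))

/-! ### Adjacency of the apexed host `(Xᶜ ⊕g ⊥)ᶜ` -/

/-- On the original part the apexed host is the original graph. [folklore] -/
theorem apex_adj_inl_inl {U : Type*} (X : SimpleGraph U) (x y : U) :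
    (Xᶜ ⊕g (⊥ : SimpleGraph (Fin 2)))ᶜ.Adj (.inl x) (.inl y) ↔ X.Adj x y := by
  simp only [SimpleGraph.compl_adj, ne_eq, Sum.inl.injEq, SimpleGraph.sum_adj, not_and, not_not]
  constructor
  · rintro ⟨hne, h⟩
    exact h hne
  · intro h
    exact ⟨X.ne_of_adj h, fun _ => h⟩

/-- Every original vertex sees both apices. [folklore] -/
theorem apex_adj_inl_inr {U : Type*} (X : SimpleGraph U) (x : U) (a : Fin 2) :
    (Xᶜ ⊕g (⊥ : SimpleGraph (Fin 2)))ᶜ.Adj (.inl x) (.inr a) := by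
  simp [SimpleGraph.compl_adj]

/-- Both apices see every original vertex. [folklore] -/
theorem apex_adj_inr_inl {U : Type*} (X : SimpleGraph U) (a : Fin 2) (x : U) :
    (Xᶜ ⊕g (⊥ : SimpleGraph (Fin 2)))ᶜ.Adj (.inr a) (.inl x) :=
  (apex_adj_inl_inr X x a).symm

/-- The two apices are adjacent (and there are no loops). [folklore] -/
theorem apex_adj_inr_inr {U : Type*} (X : SimpleGraph U) (a b : Fin 2) :
    (Xᶜ ⊕g (⊥ : SimpleGraph (Fin 2)))ᶜ.Adj (.inr a) (.inr b) ↔ a ≠ b := by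
  simp [SimpleGraph.compl_adj]

/-! ### Strictness and absorption for the apexed pair -/

variable {v : ℕ} {G : SimpleGraph (Fin v)} [DecidableRel G.Adj]
variable {W : Type*} (F : SimpleGraph W)

/-- **Strictness for the apexed pair**: if `F` retracts onto `G₂ ∨ K₂` through `ι : G₂ → F` (`ρ ∘ ι = inl`) and `e` is an
edge of `G`, then `hom(F, CFI(G,{e}) ∨ K₂) < hom(F, CFI(G,∅) ∨ K₂)` — `card_hom_ext_lt_of_retract` with all cross edges
present. [cite: ChenFlumLiu2025, Thm 12.2; Roberson2022, Thm 3.6] -/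
theorem card_hom_apex_lt_of_retract [Finite W] {e : Sym2 (Fin v)} [DecidablePred (· ∈ ({e} : Set (Sym2 (Fin v))))]
    (he : e ∈ G.edgeSet) (ι : subdiv G →g F)
    (ρ : F →g ((subdiv G)ᶜ ⊕g (⊥ : SimpleGraph (Fin 2)))ᶜ) (hρι : ∀ x, ρ (ι x) = .inl x) :
    Nat.card (F →g ((cfiGraph G ({e} : Set (Sym2 (Fin v))))ᶜ ⊕g (⊥ : SimpleGraph (Fin 2)))ᶜ) <
      Nat.card (F →g ((cfiEven G)ᶜ ⊕g (⊥ : SimpleGraph (Fin 2)))ᶜ) := by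
  refine card_hom_ext_lt_of_retract F he _ _ (fun x y h => (apex_adj_inl_inl _ x y).2 h)
    (fun x y h => (apex_adj_inl_inl _ x y).1 h)
    (fun a a' h => (apex_adj_inr_inr _ a a').2 ((apex_adj_inr_inr _ a a').1 h))
    (fun x x' a _ _ => apex_adj_inl_inr _ x' a) _ (fun x y h => (apex_adj_inl_inl _ x y).1 h)
    (fun a a' h => (apex_adj_inr_inr _ a a').2 ((apex_adj_inr_inr _ a a').1 h))
    (fun x a _ => apex_adj_inl_inr _ (zeroLift x) a) ι ρ hρι

/-- **ABSORPTION**: a `2`-coloured graph `F` with an INDUCED copy `ι : G₂ ↪g F` of the 2-subdivision retracts onto `G₂ ∨ K₂`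
— the copy goes to itself, every other vertex to the apex of its colour. [folklore] -/
theorem exists_apexRetraction_of_embedding (ι : subdiv G ↪g F) (c : F.Coloring (Fin 2)) :
    ∃ ρ : F →g ((subdiv G)ᶜ ⊕g (⊥ : SimpleGraph (Fin 2)))ᶜ, ∀ x, ρ (ι x) = .inl x := by
  classical
  -- the underlying map
  let r : W → (Fin v ⊕ Dart G) ⊕ Fin 2 := fun w =>
    if h : ∃ x, ι x = w then .inl (Classical.choose h) else .inr (c w)
  have hr_range : ∀ x, r (ι x) = .inl x := by
    intro x
    have h : ∃ x', ι x' = ι x := ⟨x, rfl⟩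
    simp only [r, dif_pos h]
    exact congrArg Sum.inl (ι.injective (Classical.choose_spec h))
  have hr_out : ∀ w, (¬ ∃ x, ι x = w) → r w = .inr (c w) := fun w h => by simp only [r, dif_neg h]
  refine ⟨⟨r, fun {a b} hab => ?_⟩, hr_range⟩
  by_cases ha : ∃ x, ι x = a <;> by_cases hb : ∃ y, ι y = b
  · obtain ⟨x, rfl⟩ := ha
    obtain ⟨y, rfl⟩ := hb
    rw [hr_range, hr_range, apex_adj_inl_inl]
    exact ι.map_adj_iff.1 hab
  · obtain ⟨x, rfl⟩ := ha
    rw [hr_range, hr_out b hb]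
    exact apex_adj_inl_inr _ _ _
  · obtain ⟨y, rfl⟩ := hb
    rw [hr_out a ha, hr_range]
    exact apex_adj_inr_inl _ _ _
  · rw [hr_out a ha, hr_out b hb, apex_adj_inr_inr]
    exact c.valid hab

/-- **THE APEX WITNESSES (unconditional).**  `G` connected on `≥ 2` vertices, `tw G ≥ k ≥ 1`, `e` an edge; `F` finite,
`2`-coloured, with an induced copy of `G₂`.  Then the apexed CFI pair over `G` is `C^k`-equivalent and `hom(F, ·)` tells it
apart. [cite: ChenFlumLiu2025, Thm 11.1, Thm 12.2; GroheOtto2015, §2] -/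
theorem apexWitness_of_embedding [Finite W] {k : ℕ} (hconn : G.Connected) (h2 : 2 ≤ v) (hk : 1 ≤ k)
    (htw : k ≤ Literature.Combinatorics.SimpleGraph.treewidth G) {e : Sym2 (Fin v)} (he : e ∈ G.edgeSet)
    [DecidablePred (· ∈ ({e} : Set (Sym2 (Fin v))))] (ι : subdiv G ↪g F) (c : F.Coloring (Fin 2)) :
    CkEquiv k ((cfiEven G)ᶜ ⊕g (⊥ : SimpleGraph (Fin 2)))ᶜ
        ((cfiGraph G ({e} : Set (Sym2 (Fin v))))ᶜ ⊕g (⊥ : SimpleGraph (Fin 2)))ᶜ ∧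
      Nat.card (F →g ((cfiGraph G ({e} : Set (Sym2 (Fin v))))ᶜ ⊕g (⊥ : SimpleGraph (Fin 2)))ᶜ) <
        Nat.card (F →g ((cfiEven G)ᶜ ⊕g (⊥ : SimpleGraph (Fin 2)))ᶜ) := by
  obtain ⟨ρ, hρ⟩ := exists_apexRetraction_of_embedding F ι c
  exact ⟨ckEquiv_apex (ChenFlumLiu2025_ckEquiv_of_le_treewidth_holds v k G hconn h2 hk htw e he),
    card_hom_apex_lt_of_retract F he ι.toHom ρ hρ⟩

/-- **The apex witnesses on a standard vertex set** `Fin m`, `m = |CFI(G)| + 2`. [cite: ChenFlumLiu2025, Thm 11.1, Thm 12.2] -/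
theorem exists_fin_apexWitness_of_embedding [Finite W] {k : ℕ} (hconn : G.Connected) (h2 : 2 ≤ v) (hk : 1 ≤ k)
    (htw : k ≤ Literature.Combinatorics.SimpleGraph.treewidth G) (hE : G.edgeSet.Nonempty)
    (ι : subdiv G ↪g F) (c : F.Coloring (Fin 2)) :
    ∃ (m : ℕ) (X Y : SimpleGraph (Fin m)), m = Fintype.card (CFIVertex G) + 2 ∧ CkEquiv k X Y ∧
      Nat.card (F →g Y) < Nat.card (F →g X) := by
  classical
  obtain ⟨e, he⟩ := hE
  obtain ⟨hck, hlt⟩ := apexWitness_of_embedding F hconn h2 hk htw he ι c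
  have hcard : Fintype.card (CFIVertex G ⊕ Fin 2) = Fintype.card (CFIVertex G) + 2 := by
    rw [Fintype.card_sum, Fintype.card_fin]
  let φ : CFIVertex G ⊕ Fin 2 ≃ Fin (Fintype.card (CFIVertex G) + 2) :=
    (Fintype.equivFin (CFIVertex G ⊕ Fin 2)).trans (finCongr hcard)
  refine ⟨Fintype.card (CFIVertex G) + 2, _, _, rfl,
    hck.iso_congr (SimpleGraph.Iso.map φ _) (SimpleGraph.Iso.map φ _), ?_⟩
  rwa [← card_hom_congr_right F (SimpleGraph.Iso.map φ ((cfiEven G)ᶜ ⊕g (⊥ : SimpleGraph (Fin 2)))ᶜ),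
    ← card_hom_congr_right F
      (SimpleGraph.Iso.map φ ((cfiGraph G ({e} : Set (Sym2 (Fin v))))ᶜ ⊕g (⊥ : SimpleGraph (Fin 2)))ᶜ)]

/-- **The apex witnesses in the line's weighted currency**: for every bipartite pattern `E` (its pattern graph is `2`-coloured
by the two sides) whose pattern graph contains an INDUCED copy of `G₂`, a `HomIndist ν k`-pair separating `hom_E` exists at
level `ν = |CFI(G)| + 2` — the `hdist` shape of `IsolationAnyLevel`. [cite: ChenFlumLiu2025, Thm 11.1, Thm 12.2; Dvorak2010, Thm 6] -/
theorem exists_homIndist_apexWitness_of_embedding {a b k : ℕ} (E : Multiset (Fin a × Fin b))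
    (hconn : G.Connected) (h2 : 2 ≤ v) (hk : 1 ≤ k)
    (htw : k ≤ Literature.Combinatorics.SimpleGraph.treewidth G) (hE : G.edgeSet.Nonempty)
    (ι : subdiv G ↪g patternGraph E) (c : (patternGraph E).Coloring (Fin 2)) :
    ∃ (ν : ℕ) (z z' : Fin ν × Fin ν → ℂ), ν = Fintype.card (CFIVertex G) + 2 ∧ HomIndist ν k z z' ∧
      eval z (homPoly E ν ℂ) ≠ eval z' (homPoly E ν ℂ) := by
  obtain ⟨m, X, Y, hm, hXY, hlt⟩ := exists_fin_apexWitness_of_embedding (patternGraph E) hconn h2 hk htw hE ι c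
  obtain ⟨z, z', hzz', hne⟩ := exists_homIndist_witness_of_ckEquiv E hXY hlt.ne'
  exact ⟨m, z, z', hm, hzz', hne⟩

/-- The pattern graph of a bipartite pattern is `2`-coloured by its two sides (so the colouring hypothesis above is free).
[folklore] -/
theorem patternGraph_coloring {a b : ℕ} (E : Multiset (Fin a × Fin b)) :
    Nonempty ((patternGraph E).Coloring (Fin 2)) := by
  refine ⟨SimpleGraph.Coloring.mk (fun u => Sum.elim (fun _ => 0) (fun _ => 1) u) ?_⟩
  rintro (u | u) (w | w) h
  · exfalso
    simp only [patternGraph, SimpleGraph.fromRel_adj] at h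
    obtain ⟨-, ⟨p, -, -, hp⟩ | ⟨p, -, -, hp⟩⟩ := h <;> cases hp
  · simp
  · simp
  · exfalso
    simp only [patternGraph, SimpleGraph.fromRel_adj] at h
    obtain ⟨-, ⟨p, -, hp, -⟩ | ⟨p, -, hp, -⟩⟩ := h <;> cases hp


/-! ### Colouring-free forms for bipartite patterns (appended) -/

/-- **The apex witnesses for a bipartite pattern, colouring supplied by the two sides**: for every pattern `E ⊆ Fin a × Fin b`
whose pattern graph contains an INDUCED copy of the 2-subdivision `G₂` of a connected base `G` on `≥ 2` vertices with
`tw G ≥ k ≥ 1` and an edge, there is a `HomIndist ν k`-pair of points of `ℂ^{ν×ν}`, `ν = |CFI(G)| + 2`, separating `hom_E` —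
the `hdist` input of `IsolationAnyLevel` and of `CFIHomMonotone.qpOrbitSymm_of_linearWitness(₂)`, with no side condition left.
[cite: ChenFlumLiu2025, Thm 11.1, Thm 12.2; Dvorak2010, Thm 6] -/
theorem exists_homIndist_apexWitness_of_embedding' {a b k : ℕ} (E : Multiset (Fin a × Fin b))
    (hconn : G.Connected) (h2 : 2 ≤ v) (hk : 1 ≤ k)
    (htw : k ≤ Literature.Combinatorics.SimpleGraph.treewidth G) (hE : G.edgeSet.Nonempty)
    (ι : subdiv G ↪g patternGraph E) :
    ∃ (ν : ℕ) (z z' : Fin ν × Fin ν → ℂ), ν = Fintype.card (CFIVertex G) + 2 ∧ HomIndist ν k z z' ∧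
      eval z (homPoly E ν ℂ) ≠ eval z' (homPoly E ν ℂ) :=
  exists_homIndist_apexWitness_of_embedding E hconn h2 hk htw hE ι (patternGraph_coloring E).some

/-- **Linear size, explicitly**: the level of the apex witnesses is at most `v·2^Δ + 2vΔ + 2` for a base on `Fin v` of maximum
degree `Δ` (so `≤ 14v + 2` for subcubic bases and `≤ 24v + 2` for grids). [cite: CaiFurerImmerman1992, §6] -/
theorem exists_homIndist_apexWitness_le {a b k : ℕ} (E : Multiset (Fin a × Fin b))
    (hconn : G.Connected) (h2 : 2 ≤ v) (hk : 1 ≤ k)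
    (htw : k ≤ Literature.Combinatorics.SimpleGraph.treewidth G) (hE : G.edgeSet.Nonempty)
    (ι : subdiv G ↪g patternGraph E) :
    ∃ (ν : ℕ) (z z' : Fin ν × Fin ν → ℂ), ν ≤ v * 2 ^ G.maxDegree + 2 * (v * G.maxDegree) + 2 ∧ HomIndist ν k z z' ∧
      eval z (homPoly E ν ℂ) ≠ eval z' (homPoly E ν ℂ) := by
  obtain ⟨ν, z, z', hν, hzz', hne⟩ := exists_homIndist_apexWitness_of_embedding' E hconn h2 hk htw hE ι
  exact ⟨ν, z, z', hν ▸ Nat.add_le_add_right card_cfiVertex_le 2, hzz', hne⟩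

end Summit.ValiantsHypothesis.ValiantsHypothesis.Theorems.CFIHomMonotone

end
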